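import Summits.BirchSwinnertonDyer.Rank1Residual.Additive.DisegniLineEndState
import Summits.BirchSwinnertonDyer.Rank1Residual.Additive.BranchPAdicGrossZagierUpperHalf
import Summits.BirchSwinnertonDyer.Rank1Residual.Additive.X3CaseOneMember
import Summits.BirchSwinnertonDyer.Rank1Residual.Additive.DisegniLineEndStateOdd
import HarnessLib

/-!
# Route `AdditiveBranchIMC` (rung K1), crux `GordTwoRankOne` (item 19358), ODD branch (`p ≡ 3 (mod 4)`,
# `p ≥ 7`): the rank-one LOWER half on every (G-ord, `e = 2`) row from published facts + the kernel MINUS-branch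
# `p`-adic Gross–Zagier identity + two per-pair typed inputs; the off-Case-1 class form on the odd slice
# (cell `bsd-addord`, seat `bsd-addord-k1-c3`, D-0074 row B2 (b); `--supports stmt-BirchSwinnertonDyer-19358 --as helper`)

HONEST FRAMING. THEOREMS ONLY: no definition, no named fact, no `sorry`, nothing booked; BSD is not proved by
any of this; the crux stays OPEN at class level (Λ-adic lower containment on the branch not in print off the
Case-1 rows; `p`-adic height non-degeneracy = rider I1). This is the `p ≡ 3 (mod 4)` twin of
`AdditiveBranchIMCGordTwoRankOneOffCaseOne.lean`, consuming the gz seat's ODD kernel chain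
(`branchPAdicGrossZagier_identity_of_cycLine_odd`, p416794; `exists_twist_newform_neg`,
`legendreMinusSymbolSum_ne_zero_of_twist`, `…EndStateInputsOdd`): MINUS modular symbols,
`L_p⁻(f, α, ω^{(p−1)/2}, T)`, `ϖ⁻·|Ω⁻_V| = Ω⁻_f`, twist by `−p`.

* §1 `exists_datum_identity_odd_of_facts` — additive (G)-ordinary row, `p ≡ 3 (mod 4)`, `p ≥ 5`, non-CM,
  `r_an = 1`, ANY good ordinary twist model `C • V^{(−p)} = W`, newform `f`, `ϖ⁻`: a datum `Dh` with
  Delbourgo 2002 (B) in both currencies and `∃ u q, L′(E,1) = q·Ω·Reg_∞ ∧ ϖ·[T¹]L_p⁻(f,α,ω^{(p−1)/2})·log_p γ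
  = u·q·Reg_p(E,Dh)`, from PUBLISHED facts (`hCyc`, `hArt`, `h73`, `hWald`, modularity, GZK).
* §2 `cellGordTwo_missingLowerBoundAt_rankOne_odd_of_facts_of_chiBranchLowerOdd_of_branchCoeffOneNeZero` —
  EVERY `N10.CellGordTwo` row, `p ≡ 3 (mod 4)`, `p ≥ 7`, non-CM, `r_an = 1`: `MissingLowerBoundAt W p` from
  the published facts + `hMaz` + `hDel` + the per-pair typed inputs `ChiBranchLowerDivisibilityOddAt W p`
  (NOT in print) and `BranchCoeffOneNeZeroAt W p` (`A′ ≠ 0`).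
* §3 X4♯ ∩ {`ρ̄` onto}, odd branch: upper half keyed to the identity, and `BSD(E,p)` from the per-pair Λ-adic
  input (displayed — the tree has no odd-branch BSTW hook) + facts + Kato's half + `A′ ≠ 0`.
* §4 the off-Case-1 class form of the seat fragment on the odd slice,
  `gordTwoRankOne_offCaseOne_odd_of_facts_of_chiBranchLowerOdd_of_branchCoeffOneNeZero` (Λ-adic input
  displayed class-wide on {(G-ord, `e = 2`), no Case-1 member, `p ≡ 3 (mod 4)`, `p ≥ 5`}; certificate and
  `¬CM` per pair). The both-parities form (∀ `p ≥ 5`) is the sibling `…GordTwoRankOneClassForm.lean`.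

NOT claimed: any Λ-adic lower containment; Schneider class-wide; `p = 3` (gz's `DisegniLineEndStateThree`
road, pending); (M); defect `3,4,6`; CM rows; no booking.

References: [Disegni2017] Thm. A, B; [Delbourgo2002] Thm. (A), (B), p. 67 (iv), p. 69; [Mazur1972Towers]
Cor. 5.15; [GrossZagier1986] I.(7.3); [Kato2004Asterisque] Thm. 17.4 (3); [MazurTateTeitelbaum1986Invent]
§I.13–14; [SkinnerUrban2014] Thm. 3.6.4 (shape only); [Miller2011LMS] Def. 1.1; cell TARGET.md E39,
planner/D0074-bsd-addord-seats.md row B2.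
-/

set_option autoImplicit false
set_option linter.dupNamespace false

noncomputable section

open scoped Classical MatrixGroups ModularForm NumberField

open CongruenceSubgroup WeierstrassCurve NumberField IsDedekindDomain Field
  Literature.NumberTheory.EllipticCurves Literature.NumberTheory.EllipticCurves.ModularForms
  Literature.NumberTheory.EllipticCurves.GreenbergVatsal2000
  Literature.NumberTheory.EllipticCurves.Rank1Residual
  Literature.NumberTheory.EllipticCurves.Rank1Residual.Typed
  Literature.NumberTheory.EllipticCurves.Delbourgo2002
  Literature.NumberTheory.EllipticCurves.Disegni2017
  Literature.NumberTheory.GaloisRepresentations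
  Summit.BirchSwinnertonDyer.Rank1Residual.AdditivePotMult
  Summit.BirchSwinnertonDyer.Rank1Residual.Additive

namespace Summit.BirchSwinnertonDyer.BirchSwinnertonDyer.Theorems.AdditiveBranchIMCGordTwoRankOne

variable {W : WeierstrassCurve ℚ} [W.IsElliptic] [W.IsGloballyMinimal] {p : ℕ} [hp : Fact p.Prime]

/-! ### §1 The datum and the MINUS-branch identity at a given good twist model, from PUBLISHED facts -/

/-- **The twisted-branch `p`-adic Gross–Zagier identity at a given triple, ODD branch, from published facts.**
`W` globally minimal without CM, ADDITIVE and (G)-ordinary at `p ≡ 3 (mod 4)`, `p ≥ 5`, `r_an(W) = 1`; ANY good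
ordinary twist model `C • V^{(−p)} = W`, newform `f` of `V`, `ϖ·|Ω⁻_V| = Ω⁻_f`: there is a height datum `Dh`
with Delbourgo 2002 Thm. (B) in both currencies and `u ∈ ℤ_p^×`, `q ∈ ℚ` with `L′(E,1) = q·Ω_E·Reg_∞(E)` and
`ϖ·[T¹]L_p⁻(f, α_V, ω^{(p−1)/2})·log_p γ = u·q·Reg_p(E,Dh)`. Inputs by name: lit's conjoined fact (B) `hCyc`,
`hArt`, `h73`, `hWald`, modularity, GZK. Chain = the gz seat's STEP C⁻(3) verbatim
(`exists_twist_newform_neg`, `legendreMinusSymbolSum_ne_zero_of_twist`, `hCyc.exists_datum_intrinsic`,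
`branchPAdicGrossZagier_identity_of_cycLine_odd`), its X3 hypothesis being idle.
[cite: Disegni2017, Theorem A (arXiv v3 PDF pp. 7–8), Theorem B (PDF p. 9), (1.1.3) (PDF pp. 4–5)]
[cite: Delbourgo2002, Theorem (B) (p. 40), p. 67 (iv), p. 69] [cite: GrossZagier1986, Thm. I.(7.3)]
[cite: Darmon2004, §3.9, proof of Thm. 3.22] [cite: MazurTateTeitelbaum1986Invent, §I.13] -/
theorem exists_datum_identity_odd_of_facts
    (hCyc : delbourgoDatum_cycLineGrossZagier)
    (hArt : rankinSelbergEulerProductHecke_baseChangeDirichlet_eq) (h73 : GrossZagier1986_thm_I_7_3)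
    (hWald : waldspurger_exists_heegnerField_twist_ne_zero)
    (hmod : hasEntireLFunction_rat) (hmodD : nonempty_modularParametrizationData)
    (hmodN : exists_isNewformOf) (hGZK : rank_eq_analyticRank_of_analyticRank_le_one)
    (haddv : Addv W p) (hG : TypeGOrd W p) (hp4 : p % 4 = 3) (hp5 : 5 ≤ p) (hcm : ¬ W.HasCM)
    (hr : W.analyticRank = 1)
    (V : WeierstrassCurve ℚ) [V.IsElliptic] [V.IsGloballyMinimal] (C : VariableChange ℚ)
    (hV : GoodOrd V p) (hC : C • V.quadraticTwist ((-1 : ℚ) ^ (p / 2) * p) = W)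
    {N : ℕ} [NeZero N] {f : CuspForm (Gamma0 N) 2} (hf : IsNewformOf V f)
    (ϖ : ℚ) (hϖ : (ϖ : ℝ) * V.imaginaryPeriodRat = minusPeriod f) :
    ∃ Dh : PAdicHeightData W p, LeadingTermClausesIntrinsic W p Dh ∧ LeadingTermClauses W p Dh ∧
      ∃ (u : ℤ_[p]ˣ) (q : ℚ),
        W.leadingLCoeff = (q : ℂ) * (W.realPeriodRat : ℂ) * (W.regulator : ℂ) ∧
        (ϖ : ℚ_[p]) *
            PowerSeries.coeff 1 (padicLFunctionMinusBranch f ((unitRoot V p : ℤ_[p]) : ℚ_[p]) (p / 2)) *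
            padicLog p (cyclotomicGenerator p) =
          ((u : ℤ_[p]) : ℚ_[p]) * (q : ℚ_[p]) * padicRegulator Dh := by
  -- adapted from gz's `ClassX3Gord.bsdp_rankOne_of_facts_of_cycLineFact_intrinsic_of_branchCoeffOneNeZeroOdd`
  have hpP : p.Prime := hp.out
  have hps : ((-1 : ℚ) ^ (p / 2) * (p : ℚ)) = -(p : ℚ) := by
    rw [pStar_eq_of_mod_four p (Or.inr hp4), if_neg (by omega)]
  have hC' : C • V.quadraticTwist (-(p : ℚ)) = W := by rw [← hps]; exact hC
  have hVW : ∃ C : VariableChange ℚ, C • V.quadraticTwist (-(p : ℚ)) = W := ⟨C, hC'⟩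
  have hordin : IsOrdinaryAt V p := ⟨hV.1, hV.2⟩
  haveI : NeZero (W.conductorNorm ℤ) := ⟨(W.conductorNorm_pos_holds).ne'⟩
  obtain ⟨DmW⟩ := hmodD W
  -- the Heegner field with `L(E^{(d_K)}, 1) ≠ 0` (Waldspurger)
  have hroot : W.rootNumber = -1 := by
    rcases rootNumber_eq_one_or_eq_neg_one W with h1 | h1
    · exfalso
      have hev1 : Even W.analyticRank :=
        (even_analyticRank_iff_rootNumber_eq_one_of_exists_isNewformOf W hmodN).mpr h1
      rw [hr] at hev1
      exact Nat.not_even_one hev1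
    · exact h1
  obtain ⟨K, _, _, hK, -, hHeeg, hLd⟩ := hWald W hroot 0
  have h2 : Module.finrank ℚ K = 2 := hK.1
  haveI : IsGalois ℚ K := isGalois_of_finrank_eq_two K h2
  have hdq : (NumberField.discr K : ℚ) ≠ 0 := by exact_mod_cast NumberField.discr_ne_zero K
  -- the Kronecker character and the twist data (odd)
  obtain ⟨κ, hκ, hκ2, hκall⟩ := exists_kroneckerChar_twistCoeff K h2
  obtain ⟨hpd, hκW, V', iV', iVm', N', _, f', hfV', hV', hap, hordV'⟩ :=
    exists_twist_newform_neg K hmodD hmodN hp4 h2 κ hκ hκall hHeeg haddv V hVW hV hf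
  have hpdN : Nat.Coprime p (NumberField.discr K).natAbs :=
    (Nat.Prime.coprime_iff_not_dvd hpP).mpr fun h ↦ hpd (Int.natCast_dvd.mpr h)
  have hS' : legendreMinusSymbolSum f' p ≠ 0 :=
    legendreMinusSymbolSum_ne_zero_of_twist K hmod hp4 κ hκW haddv V hVW hf hfV'.1
      hfV'.coeffField_eq_bot hV' hLd
  have hrd : (W.quadraticTwist (NumberField.discr K : ℚ)).mordellWeilRank = 0 := by
    haveI := W.isElliptic_quadraticTwist hdq
    have h0 : (W.quadraticTwist (NumberField.discr K : ℚ)).analyticRank = 0 :=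
      (analyticRank_eq_zero_iff_holds (hmod _)).mpr hLd
    rw [(hGZK _ (by rw [h0]; exact zero_le_one)).1, h0]
  -- the datum, in both currencies: lit's conjoined fact (B)
  obtain ⟨ι⟩ := PadicAlgCl.nonempty_ringEquiv_complex (p := p)
  have hpstar : ((pStar p : ℤ) : ℚ) = (-1 : ℚ) ^ (p / 2) * p := by
    rw [pStar, show (p - 1) / 2 = p / 2 by omega]
    push_cast
    ring
  have hCps : C • V.quadraticTwist (pStar p : ℚ) = W := by rw [hpstar]; exact hC
  obtain ⟨Dh, DhK, hres, hBι, hB, hGZc⟩ := hCyc.exists_datum_intrinsic ι hp5 hcm haddv hG hr hCps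
    (Or.inl ⟨hV.1, hordin, rfl⟩) DmW.isNewformOf hK hHeeg
  -- STEP C⁻(2): the identity at `(V, f, ϖ)`
  obtain ⟨u, q, hlead, hpgz⟩ := branchPAdicGrossZagier_identity_of_cycLine_odd ι K hp4 hArt h73 hmod
    hGZK h2 κ hκ hκ2 hpdN hrd haddv hr V V' C hC' hV hordV' hap hf DmW.isNewformOf hfV' hV' hS' ϖ hϖ
    hres hGZc
  exact ⟨Dh, hBι, hB, u, q, hlead, hpgz⟩

/-! ### §2 EVERY (G-ord, `e = 2`) row, odd branch: the LOWER half from the two per-pair typed inputs -/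

/-- **The lower half at a given good twist model, from the identity, ODD branch** (bookkeeping core):
Schneider for `Dh` (`schneiderConjecture_of_identity_of_branchCoeffOneNeZero_odd`), the rank-one lower
factorisation (`cycLowerBoundAt_of_chiBranchLowerOdd_of_identity`), Delbourgo 2002 (A) (`hDel`), the unit
factors at `𝔭 ∣ p` (Mazur 1972 Cor. 5.15 `hMaz` via `UniversalNormTwist.not_dvd_localUniversalNormIndex_of_goodOrd_twist`),
`missingLowerBoundAt_of_cycLowerBound_of_not_dvd_index`. [cite: Delbourgo2002, Theorem (A), (B) (p. 40), p. 67 (iv), p. 69]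
[cite: Mazur1972Towers, Cor. 5.15 with Remark (p. 229)] [cite: MazurTateTeitelbaum1986Invent, §I.13] [cite: Miller2011LMS, Def. 1.1] -/
theorem missingLowerBoundAt_rankOne_odd_of_model_of_identity_of_chiBranchLowerOdd_of_branchCoeffOneNeZero
    (hMaz : Mazur1972.cor515_universalNormIndex) (hDel : Delbourgo2002.mainTheorem)
    (hmod : hasEntireLFunction_rat) (hGZK : rank_eq_analyticRank_of_analyticRank_le_one)
    (haddv : Addv W p) (hG : TypeGOrd W p) (hp4 : p % 4 = 3) (hp5 : 5 ≤ p) (hcm : ¬ W.HasCM)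
    (hr : W.analyticRank = 1)
    (V : WeierstrassCurve ℚ) [V.IsElliptic] [V.IsGloballyMinimal] (C : VariableChange ℚ)
    (hV : GoodOrd V p) (hC : C • V.quadraticTwist ((-1 : ℚ) ^ (p / 2) * p) = W)
    {N : ℕ} [NeZero N] (f : CuspForm (Gamma0 N) 2) (hf : IsNewformOf V f)
    (ϖ : ℚ) (hϖ : (ϖ : ℝ) * V.imaginaryPeriodRat = minusPeriod f)
    {Dh : PAdicHeightData W p} (hBι : LeadingTermClausesIntrinsic W p Dh) {u : ℤ_[p]ˣ} {q : ℚ}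
    (hlead : W.leadingLCoeff = (q : ℂ) * (W.realPeriodRat : ℂ) * (W.regulator : ℂ))
    (hpgz : (ϖ : ℚ_[p]) *
        PowerSeries.coeff 1 (padicLFunctionMinusBranch f ((unitRoot V p : ℤ_[p]) : ℚ_[p]) (p / 2)) *
        padicLog p (cyclotomicGenerator p) = ((u : ℤ_[p]) : ℚ_[p]) * (q : ℚ_[p]) * padicRegulator Dh)
    (hdiv : ChiBranchLowerDivisibilityOddAt W p) (hne : BranchCoeffOneNeZeroAt W p) :
    MissingLowerBoundAt W p := by
  have hp2 : p ≠ 2 := by omega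
  have hps : ((-1 : ℚ) ^ (p / 2) * (p : ℚ)) = -(p : ℚ) := by
    rw [pStar_eq_of_mod_four p (Or.inr hp4), if_neg (by omega)]
  have hVW : ∃ C : VariableChange ℚ, C • V.quadraticTwist (-(p : ℚ)) = W := ⟨C, by rw [← hps]; exact hC⟩
  -- the two unit factors at the place over `p` (Mazur 1972 via the twist transport)
  set v₀ : HeightOneSpectrum (𝓞 ℚ) := (Rat.HeightOneSpectrum.primesEquiv (R := 𝓞 ℚ)).symm ⟨p, hp.out⟩
    with hv₀_def
  have hv₀ : (p : 𝓞 ℚ) ∈ v₀.asIdeal := natCast_mem_asIdeal_of_primesEquiv_eq (primesEquiv_symm_apply_coe p)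
  have hcp0 : W.tamagawaNumberAt v₀ ≠ 0 := (tamagawaNumberAt_ne_zero_and_le_four_of_addv W p haddv).1
  have hι : ∀ κ : ZpExtension ℚ p, κ.IsCyclotomic →
      localUniversalNormIndex (W := W) (v₀.adicCompletion ℚ) κ ⊤ ≠ 0 →
      ¬ p ∣ localUniversalNormIndex (W := W) (v₀.adicCompletion ℚ) κ ⊤ :=
    fun κ hκ h0 ↦ UniversalNormTwist.not_dvd_localUniversalNormIndex_of_goodOrd_twist V W κ v₀ hMaz hp2
      hV.1 (by exact_mod_cast hV.2) hκ hv₀ hC h0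
  -- (S), the lower factorisation, the lower half
  have hSch : SchneiderConjecture Dh :=
    schneiderConjecture_of_identity_of_branchCoeffOneNeZero_odd hp4 hne V C hC ⟨hV.1, hV.2⟩ f hf ϖ hϖ hpgz
  have hlow : CycLowerBoundAt W p Dh :=
    cycLowerBoundAt_of_chiBranchLowerOdd_of_identity W p hmod hGZK haddv hr hp4 V hVW hV hf ϖ hϖ hdiv
      hlead hpgz
  exact missingLowerBoundAt_of_cycLowerBound_of_not_dvd_index W p hBι hSch
    (fun κ' γ hκ' hγ D ↦ hDel.isTorsion hp5 hcm haddv hG hκ' hγ D) hGZK (by rw [hr]) v₀ hv₀ hcp0 hι hlow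

/-- **Cell (G-ord, `e = 2`) (`N10.CellGordTwo`), `p ≡ 3 (mod 4)`, `p ≥ 7` (i.e. `5 ≤ p`), `E` non-CM,
`r_an(E) = 1`, ANY residual image, ANOMALOUS OR NOT: the LOWER half `ord_p #Ш(E)_an ≤ ord_p #Ш(E)`
(`Typed.MissingLowerBoundAt W p`) from PUBLISHED named facts + TWO typed per-pair inputs** — (L) the
Λ-adic MINUS-branch lower containment `ChiBranchLowerDivisibilityOddAt W p` (NOT in print off the Case-1
rows) and (S′) the analytic certificate `BranchCoeffOneNeZeroAt W p` (`[T¹](ϖ·L_p⁻) ≠ 0`; = Schneider for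
the datum). Published binders: `hMaz`, `hCyc`, `hArt`, `h73`, `hWald`, `hDel`, modularity, GZK. Odd twin
of `cellGordTwo_missingLowerBoundAt_rankOne_of_facts_of_chiBranchLower_of_branchCoeffOneNeZero`; on the
Case-1 rows `hdiv` is `X3Branch.chiBranchLowerDivisibilityOddAt_of_facts` (p403164 §1). Nothing booked.
[cite: Delbourgo2002, Theorem (A), (B) (p. 40), p. 67 (iv), p. 69] [cite: Mazur1972Towers, Cor. 5.15]
[cite: Disegni2017, Theorem A/B (arXiv v3 PDF 7–9)] [cite: MazurTateTeitelbaum1986Invent, §I.13]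
[cite: Miller2011LMS, Def. 1.1] -/
theorem cellGordTwo_missingLowerBoundAt_rankOne_odd_of_facts_of_chiBranchLowerOdd_of_branchCoeffOneNeZero
    (hMaz : Mazur1972.cor515_universalNormIndex) (hCyc : delbourgoDatum_cycLineGrossZagier)
    (hArt : rankinSelbergEulerProductHecke_baseChangeDirichlet_eq) (h73 : GrossZagier1986_thm_I_7_3)
    (hWald : waldspurger_exists_heegnerField_twist_ne_zero) (hDel : Delbourgo2002.mainTheorem)
    (hmod : hasEntireLFunction_rat) (hmodD : nonempty_modularParametrizationData)
    (hmodN : exists_isNewformOf) (hGZK : rank_eq_analyticRank_of_analyticRank_le_one)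
    (hc : N10.CellGordTwo W p) (hp4 : p % 4 = 3) (hp5 : 5 ≤ p) (hcm : ¬ W.HasCM)
    (hr : W.analyticRank = 1)
    (hdiv : ChiBranchLowerDivisibilityOddAt W p) (hne : BranchCoeffOneNeZeroAt W p) :
    MissingLowerBoundAt W p := by
  obtain ⟨hp2, haddv, hG, he⟩ := hc
  -- the twist model, its newform and period ratio
  obtain ⟨V, iV, iVm, C, hV, hC⟩ := TypeGOrd.exists_goodOrd_pStar_twist_model W p hp2 hG haddv he
  haveI : NeZero (V.conductorNorm ℤ) := ⟨(V.conductorNorm_pos_holds).ne'⟩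
  obtain ⟨Dm⟩ := hmodD V
  obtain ⟨ϖ, -, hϖ⟩ := exists_rat_mul_imaginaryPeriodRat_eq_minusPeriod Dm
  -- §1: the datum and the identity; then the core
  obtain ⟨Dh, hBι, -, u, q, hlead, hpgz⟩ := exists_datum_identity_odd_of_facts hCyc hArt h73 hWald hmod
    hmodD hmodN hGZK haddv hG hp4 hp5 hcm hr V C hV hC Dm.isNewformOf ϖ hϖ
  exact missingLowerBoundAt_rankOne_odd_of_model_of_identity_of_chiBranchLowerOdd_of_branchCoeffOneNeZero
    hMaz hDel hmod hGZK haddv hG hp4 hp5 hcm hr V C hV hC Dm.f Dm.isNewformOf ϖ hϖ hBι hlead hpgz hdiv hne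

/-! ### §3 X4♯(G-ord) ∩ `I₀*` ∩ {`ρ̄` onto}, odd branch: `BSD(E,p)` from the per-pair Λ-adic input -/

omit [W.IsGloballyMinimal] in
/-- **X4♯(G-ord) ∩ `I₀*` ∩ {`ρ̄_{E,p}` onto}, `p ≡ 3 (mod 4)`, `r_an = 1`: the UPPER half from ONE MINUS-branch
identity + the rider + Kato's half** — copy of `ClassX4Gord.missingUpperBoundAt_rankOne_of_katoHalf_of_branchPAdicGrossZagierOdd`
keyed to a given `(V, C, f, ϖ)`. [cite: Kato2004Asterisque, Thm. 17.4 (3) (p. 273)]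
[cite: Wuthrich2014, Lemma 20 (p. 399)] [cite: Delbourgo2002, Theorem (B) (p. 40)] [cite: Miller2011LMS, Def. 1.1] -/
theorem classX4Gord_missingUpperBoundAt_rankOne_of_katoHalf_of_identity_odd [W.IsGloballyMinimal]
    (hK : Wuthrich2014.kato_halfEigenCharIdeal_dvd_cyclotomicPrime_of_surjective)
    (hGZK : rank_eq_analyticRank_of_analyticRank_le_one) (hmod : hasEntireLFunction_rat)
    (hX : ClassX4Gord W p) (hp4 : p % 4 = 3) (hsurj : Surj W p) (hr : W.analyticRank = 1)
    {Dh : PAdicHeightData W p} (hB : LeadingTermClauses W p Dh) (hS : SchneiderConjecture Dh)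
    (V : WeierstrassCurve ℚ) [V.IsElliptic] [V.IsGloballyMinimal] (hV : GoodOrd V p)
    (C : VariableChange ℚ) (hC : C • V.quadraticTwist ((-1 : ℚ) ^ (p / 2) * p) = W)
    {N : ℕ} [NeZero N] {f : CuspForm (Gamma0 N) 2} (hf : IsNewformOf V f)
    (ϖ : ℚ) (hϖ : (ϖ : ℝ) * V.imaginaryPeriodRat = minusPeriod f) {u' : ℤ_[p]ˣ} {q : ℚ}
    (hlead : W.leadingLCoeff = (q : ℂ) * (W.realPeriodRat : ℂ) * (W.regulator : ℂ))
    (hpgz : (ϖ : ℚ_[p]) *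
        PowerSeries.coeff 1 (padicLFunctionMinusBranch f ((unitRoot V p : ℤ_[p]) : ℚ_[p]) (p / 2)) *
        padicLog p (cyclotomicGenerator p) = ((u' : ℤ_[p]) : ℚ_[p]) * (q : ℚ_[p]) * padicRegulator Dh) :
    MissingUpperBoundAt W p := by
  -- adapted from `ClassX4Gord.missingUpperBoundAt_rankOne_of_katoHalf_of_branchPAdicGrossZagierOdd`
  have hp2 : p ≠ 2 := hX.addv.1
  have hodd : ¬ Even (p / 2) := by
    rw [Nat.not_even_iff_odd]
    exact ⟨p / 4, by omega⟩
  have hmw : W.mordellWeilRank = 1 := by rw [(hGZK W (by rw [hr])).1, hr]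
  obtain ⟨κ, γ, hκ, hγ, hγ', D, fE, hchar⟩ := exists_cyclotomic_dualData_generator W p
  haveI : Module.Finite (IwasawaAlgebra p) D.X :=
    SelmerDualData.module_finite_of_isCyclotomic (W := W) (κ := κ) hκ D hγ
  have hj := padicValRat_j_nonneg_of_typeGOrd W p hX.typeGOrd
  have hsV : Surj V p := (surj_iff_of_model_twist V p (pStar_ne_zero p) ⟨C, hC⟩).mp hsurj
  have hsurjV : ∀ n : ℕ, V.HasSurjectiveModNGaloisRep (p ^ n : ℕ) :=
    V.forall_hasSurjectiveModNGaloisRep_pow_of_goodOrdinary_of_surj p hp2 hV.1 hV.2 hsV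
  have hϖ' : (if Even (p / 2) then (ϖ : ℝ) * V.realPeriodRat = plusPeriod f
      else (ϖ : ℝ) * V.imaginaryPeriodRat = minusPeriod f) := by
    rw [if_neg hodd]; exact hϖ
  obtain ⟨hXt, g, hg, u, hι⟩ := isTorsion_and_exists_iota_eq_branch_of_katoComponent W p
    (Kato2004.charIdeal_dvd_padicLFunctionBranch_component_of_surjective_of_half hK) hj hp2 V
    ⟨C, hC⟩ (Or.inl hV) hsurjV hκ hγ hγ' hf D ϖ hϖ'
  rw [if_neg hodd] at hι
  have hpgz' : ((ϖ : ℚ) : ℚ_[p]) * PowerSeries.coeff W.mordellWeilRank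
        (padicLFunctionMinusBranch f ((unitRoot V p : ℤ_[p]) : ℚ_[p]) (p / 2)) *
        padicLog p (cyclotomicGenerator p) ^ W.mordellWeilRank =
      ((u' : ℤ_[p]) : ℚ_[p]) * (q : ℚ_[p]) * padicRegulator Dh := by
    rw [hmw, pow_one]
    exact hpgz
  exact missingUpperBoundAt_rankOne_of_iota_eq_of_pgz hp2 hGZK hmod hr hB hS hκ hγ hγ' D hXt hchar hg
    hι hlead hpgz'

/-- **X4♯(G-ord) ∩ `I₀*` (`e = 2`) ∩ {`ρ̄_{E,p}` onto}, `p ≡ 3 (mod 4)`, `p ≥ 7`, `E` non-CM, `r_an(E) = 1`,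
ANOMALOUS OR NOT: `BSD(E,p)` from the per-pair Λ-adic MINUS-branch lower containment
`ChiBranchLowerDivisibilityOddAt W p` (DISPLAYED — NOT in print; the tree carries no odd-branch reading of the
Burungale–Skinner–Tian–Wan twist clause), PUBLISHED named facts (`hMaz`, `hCyc`, `hArt`, `h73`, `hWald`,
`hDel`, Kato's half `hK`, modularity, GZK) and ONE analytic number `BranchCoeffOneNeZeroAt W p`.** Chain:
twist model; §1; lower = §2 core; Schneider; upper = `classX4Gord_missingUpperBoundAt_rankOne_of_katoHalf_of_identity_odd`;
glue. Odd twin of `classX4Gord_bsdp_rankOne_of_BSTW921c_OPEN_of_cycLineFact_of_katoHalf`. Nothing booked.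
[cite: Delbourgo2002, Theorem (A), (B) (p. 40), p. 67 (iv), p. 69] [cite: Mazur1972Towers, Cor. 5.15]
[cite: Kato2004Asterisque, Thm. 17.4 (3) (p. 273)] [cite: Disegni2017, Theorem A/B (arXiv v3 PDF 7–9)]
[cite: SkinnerUrban2014, Thm. 3.6.4 (p. 43) (shape only; nothing asserted)] [cite: Miller2011LMS, Def. 1.1] -/
theorem classX4Gord_bsdp_rankOne_odd_of_chiBranchLowerOdd_of_cycLineFact_of_katoHalf
    (hMaz : Mazur1972.cor515_universalNormIndex) (hCyc : delbourgoDatum_cycLineGrossZagier)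
    (hArt : rankinSelbergEulerProductHecke_baseChangeDirichlet_eq) (h73 : GrossZagier1986_thm_I_7_3)
    (hWald : waldspurger_exists_heegnerField_twist_ne_zero) (hDel : Delbourgo2002.mainTheorem)
    (hK : Wuthrich2014.kato_halfEigenCharIdeal_dvd_cyclotomicPrime_of_surjective)
    (hmod : hasEntireLFunction_rat) (hmodD : nonempty_modularParametrizationData)
    (hmodN : exists_isNewformOf) (hGZK : rank_eq_analyticRank_of_analyticRank_le_one)
    (hX : ClassX4Gord W p) (he : semistabilityIndex W p = 2) (hp4 : p % 4 = 3) (hp5 : 5 ≤ p)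
    (hcm : ¬ W.HasCM) (hsurj : Surj W p) (hr : W.analyticRank = 1)
    (hdiv : ChiBranchLowerDivisibilityOddAt W p) (hne : BranchCoeffOneNeZeroAt W p) : BSDp W p := by
  -- the twist model, its newform and period ratio
  obtain ⟨V, iV, iVm, C, hV, hC⟩ := hX.exists_goodOrd_pStar_twist_model W p he
  have hordin : IsOrdinaryAt V p := ⟨hV.1, hV.2⟩
  haveI : NeZero (V.conductorNorm ℤ) := ⟨(V.conductorNorm_pos_holds).ne'⟩
  obtain ⟨Dm⟩ := hmodD V
  obtain ⟨ϖ, -, hϖ⟩ := exists_rat_mul_imaginaryPeriodRat_eq_minusPeriod Dm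
  -- §1: the datum and the identity
  obtain ⟨Dh, hBι, hB, u, q, hlead, hpgz⟩ := exists_datum_identity_odd_of_facts hCyc hArt h73 hWald hmod
    hmodD hmodN hGZK hX.addv.2 hX.typeGOrd hp4 hp5 hcm hr V C hV hC Dm.isNewformOf ϖ hϖ
  -- lower half (§2 core), Schneider, upper half, glue
  have hl : MissingLowerBoundAt W p :=
    missingLowerBoundAt_rankOne_odd_of_model_of_identity_of_chiBranchLowerOdd_of_branchCoeffOneNeZero hMaz
      hDel hmod hGZK hX.addv.2 hX.typeGOrd hp4 hp5 hcm hr V C hV hC Dm.f Dm.isNewformOf ϖ hϖ hBι hlead hpgz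
      hdiv hne
  have hSch : SchneiderConjecture Dh :=
    schneiderConjecture_of_identity_of_branchCoeffOneNeZero_odd hp4 hne V C hC hordin Dm.f Dm.isNewformOf ϖ
      hϖ hpgz
  have hu : MissingUpperBoundAt W p :=
    classX4Gord_missingUpperBoundAt_rankOne_of_katoHalf_of_identity_odd hK hGZK hmod hX hp4 hsurj hr hB hSch
      V hV C hC Dm.isNewformOf ϖ hϖ hlead hpgz
  exact bsdp_of_missingPPartAt W p hGZK (by rw [hr]) (missingPPartAt_of_lower_of_upper W p hl hu)

/-! ### §4 The OFF-CASE-1 class form on the odd slice (seat fragment D0074 row B2) -/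

/-- **Crux `GordTwoRankOne` OFF the Case-1 rows, `p ≡ 3 (mod 4)`, `p ≥ 7`, non-CM: the class form MODULO the
displayed Λ-adic input and the per-pair certificate** (odd twin of
`gordTwoRankOne_offCaseOne_even_of_facts_of_chiBranchLower_of_branchCoeffOneNeZero`). GRANTED the Λ-adic
MINUS-branch lower containment on the slice {cell (G-ord, `e = 2`), NO Case-1 member, `p ≡ 3 (mod 4)`,
`p ≥ 5`} (`hΛ` — the rank-free Λ-adic layer of crux `GordTwoRankZeroOffCaseOne`; NOT in print, NOT asserted),
every such row of analytic rank `1` with `A′ ≠ 0` satisfies `ord_p #Ш(E)_an ≤ ord_p #Ш(E)`.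
[cite: Delbourgo2002, Theorem (A), (B) (p. 40)] [cite: Mazur1972Towers, Cor. 5.15]
[cite: SkinnerUrban2014, Thm. 3.6.4 (p. 43) (shape only; nothing asserted)] [cite: Miller2011LMS, Def. 1.1] -/
theorem gordTwoRankOne_offCaseOne_odd_of_facts_of_chiBranchLowerOdd_of_branchCoeffOneNeZero
    (hMaz : Mazur1972.cor515_universalNormIndex) (hCyc : delbourgoDatum_cycLineGrossZagier)
    (hArt : rankinSelbergEulerProductHecke_baseChangeDirichlet_eq) (h73 : GrossZagier1986_thm_I_7_3)
    (hWald : waldspurger_exists_heegnerField_twist_ne_zero) (hDel : Delbourgo2002.mainTheorem)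
    (hmod : hasEntireLFunction_rat) (hmodD : nonempty_modularParametrizationData)
    (hmodN : exists_isNewformOf) (hGZK : rank_eq_analyticRank_of_analyticRank_le_one)
    (hΛ : ∀ (W : WeierstrassCurve ℚ) [W.IsElliptic] [W.IsGloballyMinimal] (p : ℕ) [Fact p.Prime],
      N10.CellGordTwo W p → ¬ HasCaseOneMember W p → p % 4 = 3 → 5 ≤ p →
        ChiBranchLowerDivisibilityOddAt W p) :
    ∀ (W : WeierstrassCurve ℚ) [W.IsElliptic] [W.IsGloballyMinimal] (p : ℕ) [Fact p.Prime],
      W.analyticRank = 1 → N10.CellGordTwo W p → ¬ HasCaseOneMember W p →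
      p % 4 = 3 → 5 ≤ p → ¬ W.HasCM → BranchCoeffOneNeZeroAt W p → MissingLowerBoundAt W p :=
  fun W _ _ p _ hr hc hm hp4 hp5 hcm hne ↦
    cellGordTwo_missingLowerBoundAt_rankOne_odd_of_facts_of_chiBranchLowerOdd_of_branchCoeffOneNeZero hMaz
      hCyc hArt h73 hWald hDel hmod hmodD hmodN hGZK hc hp4 hp5 hcm hr (hΛ W p hc hm hp4 hp5) hne

end Summit.BirchSwinnertonDyer.BirchSwinnertonDyer.Theorems.AdditiveBranchIMCGordTwoRankOne

end
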